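import Literature.AlgebraicGeometry.ModuliOfAbelianVarieties.SymplecticLiftOfMarking
import Literature.AlgebraicGeometry.ModuliOfAbelianVarieties.SiegelModuliComplexUniformisation
import HarnessLib

/-!
# Admissibility at `(Z, r)` for the GIVEN representative `r`, from a marking read through `r`
# ([Milne 2005] Thm. 6.11 «`(A, s, ηK) ↦ [J, a]`», [Deligne 1971] 4.12 (b), [Lan 2013] Lemma 1.3.6.5)

Topic `AlgebraicGeometry/ModuliOfAbelianVarieties`; namespace `Literature.AlgebraicGeometry.ModuliOfAbelianVarieties`.
KERNEL ONLY: theorems; no definition, no named fact, no instance, no `sorry`.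

The tree's admissibility producers `exists_isAdmissibleAt_of_frame` (`SiegelAdmissibleExistence`) and
`exists_isAdmissibleAt_of_pairingRead` (`SiegelAdmissibleOfPairingRead`) start from a marking by `[J(Z₀), a₀]` framed
through some `k₀ ∈ K_δ(1)` and MOVE it (`SiegelAdelicMarking.exists_principalRep_of_frame`) to a principal representative
`r = diag(1, u·1)` and a translated period point `M⁻¹·Z₀`; their conclusion quantifies `∃ r ∃ Z`.  The period-map node of
the complex uniformisation (cell hodgecm-mathlib, U-e socket P4: «a local holomorphic period map READING ADMISSIBILITY
at the SAME `r`») needs the last step of that assembly in isolation, with `r` and `Z` FIXED: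

* `isAdmissibleAt_of_levelReading` — if the fibre of a triple `P′` over `Spec ℂ` is marked by `[J(Z), r]` (ANY
  `r ∈ GSp_δ(𝔸_f)`), carries an ample `Θ` with `λ̄ = Λ(𝒪(Θ))`, the Weil pairing of `Θ` on torsion points READ THROUGH
  `r` is `ζ_M ^ E_δ` at every level `N ∣ M` (the D5 identity, an input), and the level sections `σᵢ` are read through `r`
  at the classes `eᵢ/N`, then `P′` is admissible at `(Z, r)` (★ `IsAdmissibleAt`): the matched symplectic lift is the
  one BUILT from the marking by `SiegelAdelicMarking.exists_symplecticLift_of_levelReading` (B4 (b)).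

Everything here is proved; no definitions, no named facts.

## References

* [Milne2005ShimuraVarieties] J. S. Milne, Introduction to Shimura varieties (2005), §6 Thm. 6.11 pp. 74–75, §12 (63)
  p. 116.
* [Deligne1971TravauxShimura] P. Deligne, Travaux de Shimura, Sém. Bourbaki 389 (1971), 4.12 (b) pp. 148–149, 4.16 p. 150.
* [Lan2013PELCompactifications] K.-W. Lan, Arithmetic compactifications of PEL-type Shimura varieties (2013), §1.3.6
  Lemma 1.3.6.5 (p. 81).
-/

set_option autoImplicit false

noncomputable section

open Matrix CategoryTheory AlgebraicGeometry

namespace Literature.AlgebraicGeometry.ModuliOfAbelianVarieties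

open Literature.AlgebraicGeometry.Motives (AbelianVariety AlgPoints CartierDivisor specOver)
open Literature.AlgebraicGeometry.AbelianSchemes (AbelianSchemeOver PolarizedAbelianSchemeWithLevel)
open Literature.NumberTheory.Adeles
open Literature.NumberTheory.Automorphic (siegelUpperHalfSpace)
open SiegelModuli

variable {g : ℕ} {δ : Fin g → ℕ}

/-- **Admissibility at `(Z, r)` for the given `r`, from a marking by `[J(Z), r]` whose level and pairing readings go
through `r`.**  Let `P′` be a polarised abelian scheme of type `δ` with level-`N` structure over `Spec ℂ`, `Θ` an ample
divisor on its fibre with `λ̄ = Λ(𝒪(Θ))` (`IsLambdaOfAt`), `m` a marking of the fibre by `[J(Z), r]`, `Z ∈ 𝔥_g`,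
`r ∈ GSp_δ(𝔸_f)`, and `ζ = (ζ_M)_{N ∣ M}` a compatible system of primitive roots of unity.  If (`hpair`) the Weil pairing
of `Θ` on `M`-torsion points read at `x̃/M`, `ỹ/M` THROUGH `r` is `ζ_M ^ E_δ(x, y)` for every `N ∣ M`, and (`hlevel`)
each level section `σᵢ` is read through `r` at the class `eᵢ/N`, then `P′` is admissible at `(Z, r)`: the marking `m`,
the witness `Θ` and the symplectic lift BUILT from `m` (`exists_symplecticLift_of_levelReading`, whose whole tower is read
through `r`) are the three witnesses of `IsAdmissibleAt`. [cite: Milne2005ShimuraVarieties, §6 Thm. 6.11 pp. 74–75 and §12 (63) p. 116]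
[cite: Deligne1971TravauxShimura, 4.12 (b) pp. 148–149] [cite: Lan2013PELCompactifications, §1.3.6 Lemma 1.3.6.5 (p. 81)] -/
theorem isAdmissibleAt_of_levelReading (hδ : IsPolarizationType δ) {N : ℕ}
    (P' : PolarizedAbelianSchemeWithLevel g N δ (specOver ℚ ℂ).left)
    (Θ : CartierDivisor (P'.A.fibre (𝟙 (Spec (CommRingCat.of ℂ)))).toAbelianVariety.X.left) (hΘ : Θ.IsAmple)
    (hlam : P'.A.IsLambdaOfAt (𝟙 (Spec (CommRingCat.of ℂ))) P'.D P'.pol.lam Θ)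
    (Z : Matrix (Fin g) (Fin g) ℂ) (hZ : Z ∈ siegelUpperHalfSpace g) (r : gspFinAdelic δ)
    (m : SiegelAdelicMarking ⟨jOfSiegel δ Z, SiegelComplexRecordSystem.jOfSiegel_mem_C0pm hδ.1 hZ⟩ r
      (P'.A.fibre (𝟙 (Spec (CommRingCat.of ℂ)))).toAbelianVariety)
    (ζ : ℕ → ℂ) (hζ : ∀ ⦃M : ℕ⦄, N ∣ M → M ≠ 0 → IsPrimitiveRoot (ζ M) M)
    (hζ_pow : ∀ ⦃M : ℕ⦄ (k : ℕ), N ∣ M → M ≠ 0 → k ≠ 0 → ζ (k * M) ^ k = ζ M)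
    (hpair : ∀ ⦃M : ℕ⦄, N ∣ M → ∀ (hMΩ : (M : ℂ) ≠ 0) (x y : Fin g ⊕ Fin g → ZMod M)
      (P Q : (P'.A.fibre (𝟙 (Spec (CommRingCat.of ℂ)))).toAbelianVariety.torsionPoints ℂ (M : ℤ)),
      (∀ v, AdelicCongr ((r⁻¹ : gspFinAdelic δ) : GL (Fin g ⊕ Fin g) finAdeleQ) 1 v
          (fun i => ((x i).val : ℚ) / M) →
          (P : (P'.A.fibre (𝟙 (Spec (CommRingCat.of ℂ)))).toAbelianVariety.Points ℂ) = m.r v) →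
      (∀ w, AdelicCongr ((r⁻¹ : gspFinAdelic δ) : GL (Fin g ⊕ Fin g) finAdeleQ) 1 w
          (fun i => ((y i).val : ℚ) / M) →
          (Q : (P'.A.fibre (𝟙 (Spec (CommRingCat.of ℂ)))).toAbelianVariety.Points ℂ) = m.r w) →
      haveI := AbelianVariety.isDominant_toSchemeHom_zsmul_of_ne_zero
        (P'.A.fibre (𝟙 (Spec (CommRingCat.of ℂ)))).toAbelianVariety hMΩ
      (P'.A.fibre (𝟙 (Spec (CommRingCat.of ℂ)))).toAbelianVariety.weilPairingLevel Θ P Q =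
        ζ M ^ (AbelianSchemeOver.typeFormMod δ M x y).val)
    (hlevel : ∀ i : Fin g ⊕ Fin g, ∃ v : Fin g ⊕ Fin g → ℚ,
      AdelicCongr ((r⁻¹ : gspFinAdelic δ) : GL (Fin g ⊕ Fin g) finAdeleQ) 1 v
          (fun j => (((Pi.single i (1 : ZMod N) : Fin g ⊕ Fin g → ZMod N) j).val : ℚ) / N) ∧
        P'.A.restrictPt (𝟙 (Spec (CommRingCat.of ℂ))) (P'.level.σ i) = m.r v) :
    IsAdmissibleAt hδ r Z hZ P' := by
  obtain ⟨Λ, -, htower⟩ := m.exists_symplecticLift_of_levelReading P'.level Θ ζ hζ hζ_pow hpair hlevel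
  exact ⟨m, Θ, Λ, hΘ, hlam, htower⟩

end Literature.AlgebraicGeometry.ModuliOfAbelianVarieties

end
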